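import Summits.Parity.GeneralizedHardyLittlewood.Theses.LiouvilleMAD

/-!
# Crux `FanDecorrelation` (stmt-Parity-13318) — ideator-1 sketch `lag-window-normal-form`

First-lemma signatures for the crux idea card `lag-window-normal-form` (round 1, ideator 1).
Everything here is a `def … : Prop` (statements to be proved by stub workers at crux-plan stage)
or a definitional `theorem … := Iff.rfl / rfl`.  Nothing is assumed.

Notation.  `Q M = Nat.sqrt M + 1`; the crux's fan sum is
`fanSum c n n' M k = Σ_{j ∈ [Q,2Q)} Σ_{(m,m') ∈ (M,2M]², m − m' = k j} λ(mn+c) λ(m'n'+c)`.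
-/

namespace Summit.Parity.GeneralizedHardyLittlewood.Cruxes.FanDecorrelation.LagWindow

open Summit.Parity.GeneralizedHardyLittlewood.Theses.LiouvilleMAD
open scoped BigOperators

noncomputable section

/-- The fan sum `R_k(n,n',c;M)` verbatim from the crux. -/
def fanSum (c : ℤ) (n n' M : ℕ) (k : ℤ) : ℝ :=
  ∑ j ∈ Finset.Ico (Nat.sqrt M + 1) (2 * (Nat.sqrt M + 1)),
    ∑ p ∈ (Finset.Ioc M (2 * M) ×ˢ Finset.Ioc M (2 * M)).filter
        (fun p : ℕ × ℕ => (p.1 : ℤ) - p.2 = k * (j : ℤ)),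
      (ArithmeticFunction.liouville (Int.toNat ((p.1 : ℤ) * n + c)) : ℝ) *
        (ArithmeticFunction.liouville (Int.toNat ((p.2 : ℤ) * n' + c)) : ℝ)

/-- The crux is a statement about `fanSum` (definitional). -/
theorem fanDecorrelation_iff :
    FanDecorrelation ↔ ∀ c : ℤ, c ≠ 0 → ∃ ϑ : ℝ, ϑ < 1 / 4 ∧ ∃ C : ℝ, ∀ M n n' : ℕ, ∀ k : ℤ,
      1 ≤ n → 1 ≤ n' → n ≠ n' → n ≤ 2 * M → n' ≤ 2 * M → k ≠ 0 →
        |fanSum c n n' M k| ≤ C * (M : ℝ) ^ (3 / 4 + ϑ) :=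
  Iff.rfl

/-- The two-point (dilated, two-shift) correlation at lag `h`:
`D(h) = Σ_{(m,m') ∈ (M,2M]², m − m' = h} λ(mn+c) λ(m'n'+c)`. -/
def lagCorr (c : ℤ) (n n' M : ℕ) (h : ℤ) : ℝ :=
  ∑ p ∈ (Finset.Ioc M (2 * M) ×ˢ Finset.Ioc M (2 * M)).filter
      (fun p : ℕ × ℕ => (p.1 : ℤ) - p.2 = h),
    (ArithmeticFunction.liouville (Int.toNat ((p.1 : ℤ) * n + c)) : ℝ) *
      (ArithmeticFunction.liouville (Int.toNat ((p.2 : ℤ) * n' + c)) : ℝ)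

/-- "Second-order Chowla" reading (definitional): the fan sum is the SIGNED sum of the `Q`
two-point correlations `D(kj)`, `j ∈ [Q, 2Q)` — lags in arithmetic progression of difference `k`. -/
theorem fanSum_eq_sum_lagCorr (c : ℤ) (n n' M : ℕ) (k : ℤ) :
    fanSum c n n' M k =
      ∑ j ∈ Finset.Ico (Nat.sqrt M + 1) (2 * (Nat.sqrt M + 1)), lagCorr c n n' M (k * (j : ℤ)) :=
  rfl

/-! ### Normal forms (exact identities; stub-worker material) -/

/-- PROJECTIVE SCALING (complete multiplicativity): the instance `(tc, tn, tn')` IS the instance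
`(c, n, n')`, term by term (`λ(t x) λ(t y) = λ(x) λ(y)`; non-positive arguments give `0` on both
sides).  So the crux's family is indexed by `(n : n' : c)` with `gcd(n, n', c) = 1`. -/
def ProjectiveScaling : Prop :=
  ∀ (c : ℤ) (n n' M t : ℕ) (k : ℤ), 1 ≤ t →
    fanSum ((t : ℤ) * c) (t * n) (t * n') M k = fanSum c n n' M k

/-- SAME-MODULUS NORMAL FORM: `λ(mn+c) λ(m'n'+c) = λ(nn') · λ(n'(mn+c)) · λ(n(m'n'+c))`, and
`n'(mn+c) = N m + n'c`, `n(m'n'+c) = N m' + n c` with `N = n n'`: both factors are `λ` on residue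
classes of ONE modulus `N`, at lag `N k j + c(n' − n)` — AP-restricted plain Chowla
autocorrelations summed over `√M` lags in progression. -/
def SameModulus : Prop :=
  ∀ (c : ℤ) (n n' M : ℕ) (k : ℤ), 1 ≤ n → 1 ≤ n' →
    fanSum c n n' M k =
      (ArithmeticFunction.liouville (n * n') : ℝ) *
        ∑ j ∈ Finset.Ico (Nat.sqrt M + 1) (2 * (Nat.sqrt M + 1)),
          ∑ p ∈ (Finset.Ioc M (2 * M) ×ˢ Finset.Ioc M (2 * M)).filter
              (fun p : ℕ × ℕ => (p.1 : ℤ) - p.2 = k * (j : ℤ)),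
            (ArithmeticFunction.liouville (Int.toNat ((n * n' : ℕ) * (p.1 : ℤ) + (n' : ℤ) * c)) : ℝ) *
              (ArithmeticFunction.liouville (Int.toNat ((n * n' : ℕ) * (p.2 : ℤ) + (n : ℤ) * c)) : ℝ)

/-- MODEL CASE `(c,n,n') = (2,1,2)`: `λ(m+2) λ(2m'+2) = −λ(m+2) λ(m'+1)`, so the fan sum is MINUS
the sum over `j ∈ [Q,2Q)` of the PLAIN Chowla correlations `Σ_m λ(m+2) λ(m−kj+1)` (undilated λ,
lags `kj+1`).  Already this instance is open; it needs `λ` only up to `2M+2` (numerics to `1.6·10⁷`,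
kit j015184: Poisson variance, `max_k |R_k| ≈ 3 M^{3/4}`, no drift). -/
def ModelCase : Prop :=
  ∀ (M : ℕ) (k : ℤ),
    fanSum 2 1 2 M k =
      -(∑ j ∈ Finset.Ico (Nat.sqrt M + 1) (2 * (Nat.sqrt M + 1)),
          ∑ p ∈ (Finset.Ioc M (2 * M) ×ˢ Finset.Ioc M (2 * M)).filter
              (fun p : ℕ × ℕ => (p.1 : ℤ) - p.2 = k * (j : ℤ)),
            (ArithmeticFunction.liouville (p.1 + 2) : ℝ) * (ArithmeticFunction.liouville (p.2 + 1) : ℝ))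

/-! ### Residue splitting: every fan is a sum over `r mod k` of UNIT fans (windows of consecutive lags) -/

/-- Window-restricted cross sum of two sequences on the box `(lo, hi]²`: pairs with lag
`y − y' ∈ [L₁, L₂)`. -/
def windowSum (α β : ℕ → ℝ) (lo hi : ℕ) (L₁ L₂ : ℤ) : ℝ :=
  ∑ p ∈ (Finset.Ioc lo hi ×ˢ Finset.Ioc lo hi).filter
      (fun p : ℕ × ℕ => L₁ ≤ (p.1 : ℤ) - p.2 ∧ (p.1 : ℤ) - p.2 < L₂),
    α p.1 * β p.2

/-- The residue-class ("row") sequence `y ↦ λ((q y + r) n + c)` of dilation `n` at modulus `q`,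
class `r`: `λ` along the AP of modulus `q n` and residue `r n + c`. -/
def rowSeq (c : ℤ) (n q r : ℕ) (y : ℕ) : ℝ :=
  (ArithmeticFunction.liouville (Int.toNat (((q : ℤ) * y + r) * n + c)) : ℝ)

/-- RESIDUE SPLITTING (exact reindexing `m = k y + r`): for `1 ≤ k ≤ M`,
`R_k = Σ_{r<k} Σ_{y − y' ∈ [Q,2Q)} α_r(y) β_r(y')`, `α_r = rowSeq c n k r`, `β_r = rowSeq c n' k r`,
`y, y' ∈ ((M−r)/k, (2M−r)/k]` — each summand is a UNIT fan: a window of `Q` CONSECUTIVE lags of the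
cross-correlation of `λ` along the two APs (moduli `kn ≠ kn'`, residues `rn+c`, `rn'+c`). -/
def ResidueSplitting : Prop :=
  ∀ (c : ℤ) (n n' M k : ℕ), 1 ≤ k → k ≤ M →
    fanSum c n n' M k =
      ∑ r ∈ Finset.range k,
        windowSum (rowSeq c n k r) (rowSeq c n' k r) ((M - r) / k) ((2 * M - r) / k)
          (Nat.sqrt M + 1) (2 * (Nat.sqrt M + 1))

/-- Negative `k` is the swapped pair: `R_{−k}(n,n') = R_k(n',n)` (swap `(m,m')`). -/
def FanSumNeg : Prop :=
  ∀ (c : ℤ) (n n' M : ℕ) (k : ℤ), fanSum c n n' M (-k) = fanSum c n' n M k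

/-- Fans are EMPTY for `k ≥ 2Q` (`k j ≥ 2Q·Q > 2M > m − m'`). -/
def FanEmptyLargeK : Prop :=
  ∀ (c : ℤ) (n n' M : ℕ) (k : ℤ), (2 * (Nat.sqrt M + 1) : ℤ) ≤ k → fanSum c n n' M k = 0

/-- The coset sum `T_j` verbatim from the sibling crux `CosetDecorrelation` (stmt-Parity-13317). -/
def cosetSum (c : ℤ) (n n' M j : ℕ) : ℝ :=
  ∑ p ∈ (Finset.Ioc M (2 * M) ×ˢ Finset.Ioc M (2 * M)).filter (fun p : ℕ × ℕ => p.1 ≡ p.2 [MOD j]),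
    (ArithmeticFunction.liouville (Int.toNat ((p.1 : ℤ) * n + c)) : ℝ) *
      (ArithmeticFunction.liouville (Int.toNat ((p.2 : ℤ) * n' + c)) : ℝ)

theorem cosetDecorrelation_iff :
    CosetDecorrelation ↔ ∀ c : ℤ, c ≠ 0 → ∃ ϑ : ℝ, ϑ < 1 / 4 ∧ ∃ C : ℝ, ∀ M n n' j : ℕ,
      1 ≤ n → 1 ≤ n' → n ≠ n' → n ≤ 2 * M → n' ≤ 2 * M → Nat.sqrt M + 1 ≤ j →
        j < 2 * (Nat.sqrt M + 1) → |cosetSum c n n' M j| ≤ C * (M : ℝ) ^ (3 / 4 + ϑ) :=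
  Iff.rfl

/-- The same reindexing for cosets: `T_q = Σ_{r<q} Σ_{all lags} α_r(y) β_r(y')` (window = every lag). -/
def CosetResidueSplitting : Prop :=
  ∀ (c : ℤ) (n n' M q : ℕ), 1 ≤ q → q ≤ M →
    cosetSum c n n' M q =
      ∑ r ∈ Finset.range q,
        windowSum (rowSeq c n q r) (rowSeq c n' q r) ((M - r) / q) ((2 * M - r) / q)
          (-(M : ℤ)) (M + 1)

/-! ### The transfer `C⁺ = LagWindowLaw δ ∧ WindowedCosetLaw δ` (for some `δ > 0`) -/

/-- LAG-WINDOW LAW (regime `k ≤ M^{1/2−δ}`, ONE residue class at a time): each unit fan carries at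
most its share `C M^{1−κ}/k`.  Random-model size of a unit fan is `(Q·M/k)^{1/2} = M^{3/4} k^{−1/2}`,
which is `≤ M^{1−κ}/k` exactly when `k ≤ M^{1/2−2κ}` — the regime boundary is forced, not chosen.
A window of `Q` CONSECUTIVE lags of the cross-correlation of `λ` along two APs (moduli `kn ≠ kn'`
up to `2M^{3/2}`, length `M/k ≥ M^{1/2+δ}`): "MRT's averaged Chowla, SIGNED, with a saving of a
power of the window below the Parseval wall `M/k`".  Open (beyond GRH); numerically Poisson. -/
def LagWindowLaw (δ : ℝ) : Prop :=
  ∀ c : ℤ, c ≠ 0 → ∃ κ : ℝ, 0 < κ ∧ ∃ C : ℝ, ∀ M n n' k r : ℕ,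
    1 ≤ n → 1 ≤ n' → n ≠ n' → n ≤ 2 * M → n' ≤ 2 * M → 1 ≤ k →
      (k : ℝ) ≤ (M : ℝ) ^ (1 / 2 - δ) → r < k →
        |windowSum (rowSeq c n k r) (rowSeq c n' k r) ((M - r) / k) ((2 * M - r) / k)
            (Nat.sqrt M + 1) (2 * (Nat.sqrt M + 1))| ≤ C * (M : ℝ) ^ (1 - κ) / k

/-- WINDOWED COSET LAW (moduli `q ∈ [M^{1/2−δ}, 2Q)`, ALL classes summed, ANY lag window
`[L₁, L₂)`): decorrelation ACROSS the `q` residue classes of windowed products of class-restricted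
`λ`-sums.  With the full window it is `CosetDecorrelation` (13317) on the extended modulus range;
with the window `[Q,2Q)` and `q = k` it is the large-`k` fan.  In this regime the random model
itself forbids class-by-class bounds (`√q · M^{3/4} q^{−1/2}`-type losses reach `M`), so the sign
cancellation over `r mod q` is the whole content — the COSET mechanism, shared with 13317. -/
def WindowedCosetLaw (δ : ℝ) : Prop :=
  ∀ c : ℤ, c ≠ 0 → ∃ ϑ : ℝ, ϑ < 1 / 4 ∧ ∃ C : ℝ, ∀ M n n' q : ℕ, ∀ L₁ L₂ : ℤ,
    1 ≤ n → 1 ≤ n' → n ≠ n' → n ≤ 2 * M → n' ≤ 2 * M →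
      (M : ℝ) ^ (1 / 2 - δ) ≤ q → q < 2 * (Nat.sqrt M + 1) →
        |∑ r ∈ Finset.range q,
            windowSum (rowSeq c n q r) (rowSeq c n' q r) ((M - r) / q) ((2 * M - r) / q) L₁ L₂|
          ≤ C * (M : ℝ) ^ (3 / 4 + ϑ)

/-- CARD ASSEMBLY for the fan crux: bookkeeping identities + the two laws (same `δ`) ⟹
`FanDecorrelation` (small `k` by `ResidueSplitting` + `LagWindowLaw` summed over `r < k`;
`k ∈ [M^{1/2−δ}, 2Q)` by `ResidueSplitting` + `WindowedCosetLaw` with window `[Q,2Q)`; `k ≥ 2Q`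
empty; `k < 0` by the swap; `ϑ = max(ϑ₂, 1/4 − κ)`).  Pure bookkeeping, provable now. -/
def FanFromLaws : Prop :=
  ResidueSplitting → FanSumNeg → FanEmptyLargeK →
    ∀ δ : ℝ, 0 < δ → LagWindowLaw δ → WindowedCosetLaw δ → FanDecorrelation

/-- … and the sibling crux from the SAME coset law (full lag window, `q = j ∈ [Q,2Q)`). -/
def CosetFromLaw : Prop :=
  CosetResidueSplitting → ∀ δ : ℝ, 0 < δ → WindowedCosetLaw δ → CosetDecorrelation

/-- Hence MAD (both decorrelation cruxes of route LiouvilleMAD) from `C⁺`. -/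
def MADFromLaws : Prop :=
  ResidueSplitting → FanSumNeg → FanEmptyLargeK → CosetResidueSplitting →
    ∀ δ : ℝ, 0 < δ → LagWindowLaw δ → WindowedCosetLaw δ → CosetDecorrelation ∧ FanDecorrelation

/-! ### The umbrella: "second-order Chowla along progressions of lags" -/

/-- CORRELATION-NOISE LAW (umbrella transfer `C⁺⁺`; random-model exact): for every decimation
step `k ≥ 1`, every lag window `[L₁, L₂)` of at most `M^{1−2κ}` lags and every frequency `θ`,
the twisted window sum of the decimated two-point correlation sequence `i ↦ D(k i)` is
`≤ C M^{1−κ}` (its random size is `(#lags · M)^{1/2} ≤ M^{1−κ}`; `κ < 1/4` keeps the fan window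
`Q ≍ √M` and the coset range `2√M` inside the cap, and the law is not monotone in `κ`).  Contains: the fan crux
(`θ = 0`, window `[Q,2Q)`), the coset crux (`k = j ≥ Q`, window = all `|i| ≤ M/j`, `θ = 0`),
and their twisted / windowed versions (`LagWindowLaw` summed over classes, `WindowedCosetLaw`).
It is FALSE without the cap on the number of lags (all lags, `k = 1`: `|S_a(θ)|·|S_b(θ)| ≍ M`). -/
def CorrelationNoiseLaw : Prop :=
  ∀ c : ℤ, c ≠ 0 → ∃ κ : ℝ, 0 < κ ∧ κ < 1 / 4 ∧ ∃ C : ℝ, ∀ M n n' k : ℕ, ∀ L₁ L₂ : ℤ, ∀ θ : ℝ,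
    1 ≤ n → 1 ≤ n' → n ≠ n' → n ≤ 2 * M → n' ≤ 2 * M → 1 ≤ k →
      ((L₂ - L₁ : ℤ) : ℝ) ≤ (M : ℝ) ^ (1 - 2 * κ) →
        ‖∑ i ∈ Finset.Ico L₁ L₂,
            (lagCorr c n n' M ((k : ℤ) * i) : ℂ) * Complex.exp (2 * Real.pi * Complex.I * θ * i)‖
          ≤ C * (M : ℝ) ^ (1 - κ)

/-- Umbrella assembly: bookkeeping + `CorrelationNoiseLaw` ⟹ both decorrelation cruxes
(`θ = 0`; fan: window `[Q,2Q)` has `Q ≤ M^{1−2κ}` lags once `κ < 1/4`; coset: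
`T_j = Σ_{|i| ≤ (M−1)/j} D(j i)`, `≤ 2√M + 1` lags; negative `k` by `FanSumNeg`). -/
def MADFromNoise : Prop :=
  FanSumNeg → FanEmptyLargeK → CorrelationNoiseLaw → CosetDecorrelation ∧ FanDecorrelation

/-! ### Proofs of the bookkeeping identities (levers that are THEOREMS) -/

section Proofs

open ArithmeticFunction

theorem liouville_mul_of_ne_zero {a b : ℕ} (ha : a ≠ 0) (hb : b ≠ 0) :
    liouville (a * b) = liouville a * liouville b := by
  rw [liouville_apply (mul_ne_zero ha hb), liouville_apply ha, liouville_apply hb,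
    cardFactors_mul ha hb, pow_add]

theorem liouville_two : liouville 2 = -1 := by
  rw [liouville_apply two_ne_zero, cardFactors_apply_prime Nat.prime_two]; norm_num

theorem liouville_sq_cast {t : ℕ} (ht : t ≠ 0) :
    (liouville t : ℝ) * (liouville t : ℝ) = 1 := by
  rw [liouville_apply ht]; push_cast
  rw [← pow_add, ← two_mul, pow_mul]; norm_num

/-- `λ(t·x) = λ(t) λ(x)` in the crux's `Int.toNat` convention (both sides vanish for `x ≤ 0`). -/
theorem liouville_toNat_mul (t : ℕ) (ht : 1 ≤ t) (x : ℤ) :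
    (liouville (Int.toNat ((t : ℤ) * x)) : ℝ) =
      (liouville t : ℝ) * (liouville (Int.toNat x) : ℝ) := by
  rcases le_or_gt x 0 with hx | hx
  · have h1 : Int.toNat ((t : ℤ) * x) = 0 :=
      Int.toNat_eq_zero.mpr (mul_nonpos_of_nonneg_of_nonpos (by positivity) hx)
    have h2 : Int.toNat x = 0 := Int.toNat_eq_zero.mpr hx
    simp [h1, h2]
  · have hx' : Int.toNat ((t : ℤ) * x) = t * Int.toNat x := by
      have : ((t : ℤ) * x) = ((t * Int.toNat x : ℕ) : ℤ) := by
        push_cast; rw [Int.toNat_of_nonneg hx.le]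
      rw [this, Int.toNat_natCast]
    have hxne : Int.toNat x ≠ 0 := by
      intro h; rw [Int.toNat_eq_zero] at h; exact absurd hx (not_lt.mpr h)
    rw [hx', liouville_mul_of_ne_zero (by omega) hxne]
    push_cast; ring

/-- PROVED: projective scaling. -/
theorem projectiveScaling_holds : ProjectiveScaling := by
  intro c n n' M t k ht
  unfold fanSum
  refine Finset.sum_congr rfl fun j _ => Finset.sum_congr rfl fun p _ => ?_
  have e1 : (p.1 : ℤ) * ((t * n : ℕ) : ℤ) + (t : ℤ) * c = (t : ℤ) * ((p.1 : ℤ) * n + c) := by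
    push_cast; ring
  have e2 : (p.2 : ℤ) * ((t * n' : ℕ) : ℤ) + (t : ℤ) * c = (t : ℤ) * ((p.2 : ℤ) * n' + c) := by
    push_cast; ring
  rw [e1, e2, liouville_toNat_mul t ht, liouville_toNat_mul t ht]
  have hsq := liouville_sq_cast (t := t) (by omega)
  calc (liouville t : ℝ) * (liouville (Int.toNat ((p.1 : ℤ) * n + c)) : ℝ) *
        ((liouville t : ℝ) * (liouville (Int.toNat ((p.2 : ℤ) * n' + c)) : ℝ))
      = ((liouville t : ℝ) * (liouville t : ℝ)) *
          ((liouville (Int.toNat ((p.1 : ℤ) * n + c)) : ℝ) *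
            (liouville (Int.toNat ((p.2 : ℤ) * n' + c)) : ℝ)) := by ring
    _ = _ := by rw [hsq, one_mul]

/-- PROVED: the model case `(2,1,2)` is minus a window of PLAIN Chowla correlations. -/
theorem modelCase_holds : ModelCase := by
  intro M k
  unfold fanSum
  rw [← Finset.sum_neg_distrib]
  refine Finset.sum_congr rfl fun j _ => ?_
  rw [← Finset.sum_neg_distrib]
  refine Finset.sum_congr rfl fun p _ => ?_
  have h1 : Int.toNat ((p.1 : ℤ) * ((1 : ℕ) : ℤ) + 2) = p.1 + 2 := by
    have : ((p.1 : ℤ) * ((1 : ℕ) : ℤ) + 2) = ((p.1 + 2 : ℕ) : ℤ) := by push_cast; ring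
    rw [this, Int.toNat_natCast]
  have h2 : Int.toNat ((p.2 : ℤ) * ((2 : ℕ) : ℤ) + 2) = 2 * (p.2 + 1) := by
    have : ((p.2 : ℤ) * ((2 : ℕ) : ℤ) + 2) = ((2 * (p.2 + 1) : ℕ) : ℤ) := by push_cast; ring
    rw [this, Int.toNat_natCast]
  rw [h1, h2, liouville_mul_of_ne_zero two_ne_zero (Nat.succ_ne_zero _), liouville_two]
  push_cast; ring

/-- PROVED: fans are empty for `k ≥ 2Q`. -/
theorem fanEmptyLargeK_holds : FanEmptyLargeK := by
  intro c n n' M k hk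
  unfold fanSum
  refine Finset.sum_eq_zero fun j hj => Finset.sum_eq_zero fun p hp => ?_
  exfalso
  rw [Finset.mem_filter, Finset.mem_product, Finset.mem_Ioc, Finset.mem_Ioc] at hp
  rw [Finset.mem_Ico] at hj
  obtain ⟨⟨⟨_, h2⟩, ⟨h3, _⟩⟩, heq⟩ := hp
  have hQ : M < (Nat.sqrt M + 1) * (Nat.sqrt M + 1) := Nat.lt_succ_sqrt M
  have hQ' : ((M : ℕ) : ℤ) < ((Nat.sqrt M + 1 : ℕ) : ℤ) * ((Nat.sqrt M + 1 : ℕ) : ℤ) := by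
    exact_mod_cast hQ
  have hj' : ((Nat.sqrt M + 1 : ℕ) : ℤ) ≤ (j : ℤ) := by exact_mod_cast hj.1
  have hk' : 2 * ((Nat.sqrt M + 1 : ℕ) : ℤ) ≤ k := by push_cast; exact_mod_cast hk
  have hprod : 2 * ((Nat.sqrt M + 1 : ℕ) : ℤ) * ((Nat.sqrt M + 1 : ℕ) : ℤ) ≤ k * (j : ℤ) :=
    mul_le_mul hk' hj' (by positivity) (le_trans (by positivity) hk')
  have h2' : (p.1 : ℤ) ≤ 2 * (M : ℤ) := by exact_mod_cast h2
  have h3' : (M : ℤ) + 1 ≤ (p.2 : ℤ) := by exact_mod_cast h3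
  nlinarith

/-- PROVED: `R_{−k}(n,n') = R_k(n',n)` (swap the pair). -/
theorem fanSumNeg_holds : FanSumNeg := by
  intro c n n' M k
  unfold fanSum
  refine Finset.sum_congr rfl fun j _ => ?_
  refine Finset.sum_nbij' Prod.swap Prod.swap ?_ ?_ (fun _ _ => rfl) (fun _ _ => rfl) ?_
  · intro p hp
    rw [Finset.mem_filter, Finset.mem_product] at hp ⊢
    refine ⟨⟨hp.1.2, hp.1.1⟩, ?_⟩
    simp only [Prod.fst_swap, Prod.snd_swap]
    linarith [hp.2]
  · intro p hp
    rw [Finset.mem_filter, Finset.mem_product] at hp ⊢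
    refine ⟨⟨hp.1.2, hp.1.1⟩, ?_⟩
    simp only [Prod.fst_swap, Prod.snd_swap]
    linarith [hp.2]
  · intro p _
    simp only [Prod.fst_swap, Prod.snd_swap]
    ring

end Proofs

/-! ### Proof of `ResidueSplitting` (the card's first lemma) -/

section ResidueSplittingProof

open ArithmeticFunction

/-- For `k ≥ 1` at most one `j` has `d = k j`; summing the indicator over `j ∈ [Q,2Q)` leaves the
divisibility-and-window condition. -/
theorem sum_Ico_ite_eq_mul (d : ℤ) (k Qn : ℕ) (hk : 1 ≤ k) (x : ℝ) :
    (∑ j ∈ Finset.Ico Qn (2 * Qn), if d = (k : ℤ) * (j : ℤ) then x else 0) =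
      if ((k : ℤ) ∣ d ∧ (Qn : ℤ) ≤ d / k ∧ d / k < 2 * (Qn : ℤ)) then x else 0 := by
  have hk0 : (k : ℤ) ≠ 0 := by exact_mod_cast (show k ≠ 0 by omega)
  by_cases h : ((k : ℤ) ∣ d ∧ (Qn : ℤ) ≤ d / k ∧ d / k < 2 * (Qn : ℤ))
  · rw [if_pos h]
    obtain ⟨hdvd, hlo, hhi⟩ := h
    have hnn : 0 ≤ d / k := le_trans (by positivity) hlo
    set j₀ : ℕ := Int.toNat (d / k) with hj₀
    have hj₀c : (j₀ : ℤ) = d / k := by rw [hj₀, Int.toNat_of_nonneg hnn]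
    have hmem : j₀ ∈ Finset.Ico Qn (2 * Qn) := by
      rw [Finset.mem_Ico]; constructor <;> omega
    rw [Finset.sum_eq_single_of_mem j₀ hmem]
    · rw [if_pos]; rw [hj₀c]; exact (Int.mul_ediv_cancel' hdvd).symm
    · intro j _ hne
      rw [if_neg]
      intro heq
      apply hne
      have : (j : ℤ) = d / k := by rw [heq, Int.mul_ediv_cancel_left _ hk0]
      have : (j : ℤ) = j₀ := by rw [this, hj₀c]
      exact_mod_cast this
  · rw [if_neg h]
    refine Finset.sum_eq_zero fun j hj => ?_
    rw [if_neg]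
    intro heq
    apply h
    rw [Finset.mem_Ico] at hj
    have hq : d / k = j := by rw [heq, Int.mul_ediv_cancel_left _ hk0]
    refine ⟨⟨j, heq⟩, ?_, ?_⟩ <;> rw [hq] <;> omega

/-- PROVED: residue splitting (the card's first lemma). -/
theorem residueSplitting_holds : ResidueSplitting := by
  intro c n n' M k hk hkM
  have hk0 : 0 < k := hk
  have hkz : (k : ℤ) ≠ 0 := by exact_mod_cast (show k ≠ 0 by omega)
  set Qn : ℕ := Nat.sqrt M + 1 with hQn
  have eQ : ((Nat.sqrt M : ℤ) + 1) = ((Qn : ℕ) : ℤ) := by rw [hQn]; push_cast; ring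
  simp only [eQ]
  set box : Finset ℕ := Finset.Ioc M (2 * M) with hbox
  -- the summand as a function of the pair (m, m')
  set g : ℕ × ℕ → ℝ := fun p =>
    (liouville (Int.toNat ((p.1 : ℤ) * n + c)) : ℝ) *
      (liouville (Int.toNat ((p.2 : ℤ) * n' + c)) : ℝ) with hg
  -- the fan condition on a pair
  set cond : ℕ × ℕ → Prop := fun p =>
    (k : ℤ) ∣ ((p.1 : ℤ) - p.2) ∧ (Qn : ℤ) ≤ ((p.1 : ℤ) - p.2) / k ∧
      ((p.1 : ℤ) - p.2) / k < 2 * (Qn : ℤ) with hcond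
  -- Step A: the fan sum is the sum of g over the pairs satisfying cond
  have hA : fanSum c n n' M k = ∑ p ∈ (box ×ˢ box).filter cond, g p := by
    unfold fanSum
    rw [Finset.sum_filter]
    have : ∀ j ∈ Finset.Ico Qn (2 * Qn),
        (∑ p ∈ (box ×ˢ box).filter (fun p : ℕ × ℕ => (p.1 : ℤ) - p.2 = (k : ℤ) * (j : ℤ)), g p) =
          ∑ p ∈ box ×ˢ box, if (p.1 : ℤ) - p.2 = (k : ℤ) * (j : ℤ) then g p else 0 := by
      intro j _; rw [Finset.sum_filter]
    rw [Finset.sum_congr rfl this, Finset.sum_comm]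
    refine Finset.sum_congr rfl fun p _ => ?_
    exact sum_Ico_ite_eq_mul ((p.1 : ℤ) - p.2) k Qn hk (g p)
  -- Step B: the right-hand side as a sum over triples (r, (y, y'))
  set big : Finset (ℕ × ℕ) := Finset.Ioc 0 (2 * M) ×ˢ Finset.Ioc 0 (2 * M) with hbig
  set P : ℕ × (ℕ × ℕ) → Prop := fun x =>
    (x.2.1 ∈ Finset.Ioc ((M - x.1) / k) ((2 * M - x.1) / k) ∧
      x.2.2 ∈ Finset.Ioc ((M - x.1) / k) ((2 * M - x.1) / k)) ∧
    ((Qn : ℤ) ≤ (x.2.1 : ℤ) - x.2.2 ∧ (x.2.1 : ℤ) - x.2.2 < 2 * (Qn : ℤ)) with hP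
  set f : ℕ × (ℕ × ℕ) → ℝ := fun x => rowSeq c n k x.1 x.2.1 * rowSeq c n' k x.1 x.2.2 with hf
  have hB : (∑ r ∈ Finset.range k,
      windowSum (rowSeq c n k r) (rowSeq c n' k r) ((M - r) / k) ((2 * M - r) / k) Qn (2 * Qn)) =
        ∑ x ∈ (Finset.range k ×ˢ big).filter P, f x := by
    rw [Finset.sum_filter, Finset.sum_product]
    refine Finset.sum_congr rfl fun r hr => ?_
    unfold windowSum
    rw [Finset.sum_filter]
    -- enlarge the inner box to `big`
    have hsub : Finset.Ioc ((M - r) / k) ((2 * M - r) / k) ⊆ Finset.Ioc 0 (2 * M) := by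
      intro y hy
      rw [Finset.mem_Ioc] at hy ⊢
      refine ⟨lt_of_le_of_lt (Nat.zero_le _) hy.1, le_trans hy.2 (Nat.div_le_self _ _ |>.trans (Nat.sub_le _ _))⟩
    symm
    rw [← Finset.sum_subset (Finset.product_subset_product hsub hsub)]
    · refine Finset.sum_congr rfl fun q hq => ?_
      rw [Finset.mem_product] at hq
      simp only [hf]
      by_cases hw : (Qn : ℤ) ≤ (q.1 : ℤ) - q.2 ∧ (q.1 : ℤ) - q.2 < 2 * (Qn : ℤ)
      · rw [if_pos ⟨hq, hw⟩, if_pos hw]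
      · rw [if_neg (fun h => hw h.2), if_neg hw]
    · intro q _ hq
      rw [if_neg]
      intro hPq
      exact hq (Finset.mem_product.mpr hPq.1)
  rw [hA, hB]
  -- Step C: the bijection (r, (y, y')) ↦ (k y + r, k y' + r)
  symm
  refine Finset.sum_nbij' (fun x => (k * x.2.1 + x.1, k * x.2.2 + x.1))
    (fun p => (p.1 % k, (p.1 / k, p.2 / k))) ?_ ?_ ?_ ?_ ?_
  · -- maps into the filtered box
    intro x hx
    rw [Finset.mem_filter, Finset.mem_product, Finset.mem_range] at hx
    obtain ⟨⟨hr, _⟩, ⟨hy, hy'⟩, hw1, hw2⟩ := hx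
    rw [Finset.mem_Ioc] at hy hy'
    have hrM : x.1 ≤ M := by omega
    rw [Finset.mem_filter, Finset.mem_product, hbox, Finset.mem_Ioc, Finset.mem_Ioc]
    have h1 : M - x.1 < x.2.1 * k := (Nat.div_lt_iff_lt_mul hk0).mp hy.1
    have h2 : x.2.1 * k ≤ 2 * M - x.1 := (Nat.le_div_iff_mul_le hk0).mp hy.2
    have h3 : M - x.1 < x.2.2 * k := (Nat.div_lt_iff_lt_mul hk0).mp hy'.1
    have h4 : x.2.2 * k ≤ 2 * M - x.1 := (Nat.le_div_iff_mul_le hk0).mp hy'.2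
    have h1' : M < x.2.1 * k + x.1 := (tsub_lt_iff_right hrM).mp h1
    have h2' : x.2.1 * k + x.1 ≤ 2 * M := (Nat.le_sub_iff_add_le (by omega)).mp h2
    have h3' : M < x.2.2 * k + x.1 := (tsub_lt_iff_right hrM).mp h3
    have h4' : x.2.2 * k + x.1 ≤ 2 * M := (Nat.le_sub_iff_add_le (by omega)).mp h4
    refine ⟨⟨⟨?_, ?_⟩, ⟨?_, ?_⟩⟩, ?_⟩
    · show M < k * x.2.1 + x.1; linarith [mul_comm k x.2.1]
    · show k * x.2.1 + x.1 ≤ 2 * M; linarith [mul_comm k x.2.1]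
    · show M < k * x.2.2 + x.1; linarith [mul_comm k x.2.2]
    · show k * x.2.2 + x.1 ≤ 2 * M; linarith [mul_comm k x.2.2]
    · simp only [hcond]
      have hd : (((k * x.2.1 + x.1 : ℕ) : ℤ) - ((k * x.2.2 + x.1 : ℕ) : ℤ)) =
          (k : ℤ) * ((x.2.1 : ℤ) - x.2.2) := by push_cast; ring
      rw [hd, Int.mul_ediv_cancel_left _ hkz]
      exact ⟨dvd_mul_right _ _, hw1, hw2⟩
  · -- the inverse maps into the triples
    intro p hp
    rw [Finset.mem_filter, Finset.mem_product, hbox, Finset.mem_Ioc, Finset.mem_Ioc] at hp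
    obtain ⟨⟨⟨h1, h2⟩, ⟨h3, h4⟩⟩, hdvd, hw1, hw2⟩ := hp
    have hmod : p.2 % k = p.1 % k := Nat.modEq_iff_dvd.mpr hdvd
    have e2' : k * (p.2 / k) + p.1 % k = p.2 := by rw [← hmod]; exact Nat.div_add_mod p.2 k
    set y := p.1 / k with hy
    set y' := p.2 / k with hy'
    set r := p.1 % k with hr
    have e1 : k * y + r = p.1 := Nat.div_add_mod p.1 k
    have e2 : k * y' + r = p.2 := e2'
    have hlt : r < k := Nat.mod_lt _ hk0
    have hrM : r ≤ M := by omega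
    rw [Finset.mem_filter, Finset.mem_product, Finset.mem_range]
    simp only [hP, hbig, Finset.mem_product, Finset.mem_Ioc]
    have hd : ((p.1 : ℤ) - p.2) / k = (y : ℤ) - (y' : ℤ) := by
      have : ((p.1 : ℤ) - p.2) = (k : ℤ) * ((y : ℤ) - (y' : ℤ)) := by
        have a1 : ((p.1 : ℕ) : ℤ) = ((k * y + r : ℕ) : ℤ) := by rw [e1]
        have a2 : ((p.2 : ℕ) : ℤ) = ((k * y' + r : ℕ) : ℤ) := by rw [e2]
        rw [a1, a2]; simp only [Nat.cast_add, Nat.cast_mul]; ring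
      rw [this, Int.mul_ediv_cancel_left _ hkz]
    rw [hd] at hw1 hw2
    have hy0 : 0 < y := Nat.pos_of_ne_zero fun h0 => by
      rw [h0, mul_zero, zero_add] at e1; omega
    have hy0' : 0 < y' := Nat.pos_of_ne_zero fun h0 => by
      rw [h0, mul_zero, zero_add] at e2; omega
    have hyM : y ≤ 2 * M :=
      calc y ≤ k * y := Nat.le_mul_of_pos_left y hk0
        _ ≤ k * y + r := Nat.le_add_right _ _
        _ = p.1 := e1
        _ ≤ 2 * M := h2
    have hyM' : y' ≤ 2 * M :=
      calc y' ≤ k * y' := Nat.le_mul_of_pos_left y' hk0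
        _ ≤ k * y' + r := Nat.le_add_right _ _
        _ = p.2 := e2
        _ ≤ 2 * M := h4
    refine ⟨⟨hlt, ⟨hy0, hyM⟩, ⟨hy0', hyM'⟩⟩, ⟨⟨?_, ?_⟩, ⟨?_, ?_⟩⟩, hw1, hw2⟩
    · rw [Nat.div_lt_iff_lt_mul hk0, mul_comm]
      exact (tsub_lt_iff_right hrM).mpr (by rw [e1]; exact h1)
    · rw [Nat.le_div_iff_mul_le hk0, mul_comm]
      exact (Nat.le_sub_iff_add_le (by omega)).mpr (by rw [e1]; exact h2)
    · rw [Nat.div_lt_iff_lt_mul hk0, mul_comm]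
      exact (tsub_lt_iff_right hrM).mpr (by rw [e2]; exact h3)
    · rw [Nat.le_div_iff_mul_le hk0, mul_comm]
      exact (Nat.le_sub_iff_add_le (by omega)).mpr (by rw [e2]; exact h4)
  · -- left inverse
    intro x hx
    rw [Finset.mem_filter, Finset.mem_product, Finset.mem_range] at hx
    obtain ⟨⟨hr, _⟩, _⟩ := hx
    ext
    · show (k * x.2.1 + x.1) % k = x.1
      rw [Nat.mul_add_mod, Nat.mod_eq_of_lt hr]
    · show (k * x.2.1 + x.1) / k = x.2.1
      rw [Nat.mul_add_div hk0, Nat.div_eq_of_lt hr, add_zero]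
    · show (k * x.2.2 + x.1) / k = x.2.2
      rw [Nat.mul_add_div hk0, Nat.div_eq_of_lt hr, add_zero]
  · -- right inverse
    intro p hp
    rw [Finset.mem_filter] at hp
    obtain ⟨_, hdvd, _⟩ := hp
    have hmod : p.2 % k = p.1 % k := Nat.modEq_iff_dvd.mpr hdvd
    ext
    · show k * (p.1 / k) + p.1 % k = p.1
      exact Nat.div_add_mod p.1 k
    · show k * (p.2 / k) + p.1 % k = p.2
      rw [← hmod]; exact Nat.div_add_mod p.2 k
  · -- summands agree
    intro x _
    simp only [hf, hg, rowSeq, Nat.cast_add, Nat.cast_mul]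

end ResidueSplittingProof

/-! ### Proof of the card assembly `FanFromLaws` (C⁺ ⟹ crux, kernel-checked bookkeeping) -/

section AssemblyProof

open ArithmeticFunction

theorem abs_liouville_cast_le_one (x : ℕ) : |(liouville x : ℝ)| ≤ 1 := by
  rcases eq_or_ne x 0 with rfl | hx
  · simp
  · rw [liouville_apply hx]; push_cast
    rw [abs_pow, abs_neg, abs_one, one_pow]

/-- Trivial bound `|R_k| ≤ (⌊√M⌋+1)·M²`. -/
theorem abs_fanSum_le (c : ℤ) (n n' M : ℕ) (k : ℤ) :
    |fanSum c n n' M k| ≤ ((Nat.sqrt M + 1 : ℕ) : ℝ) * (M : ℝ) ^ 2 := by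
  unfold fanSum
  refine (Finset.abs_sum_le_sum_abs _ _).trans ?_
  have hinner : ∀ j ∈ Finset.Ico (Nat.sqrt M + 1) (2 * (Nat.sqrt M + 1)),
      |∑ p ∈ (Finset.Ioc M (2 * M) ×ˢ Finset.Ioc M (2 * M)).filter
          (fun p : ℕ × ℕ => (p.1 : ℤ) - p.2 = k * (j : ℤ)),
        (liouville (Int.toNat ((p.1 : ℤ) * n + c)) : ℝ) *
          (liouville (Int.toNat ((p.2 : ℤ) * n' + c)) : ℝ)| ≤ (M : ℝ) ^ 2 := by
    intro j _
    refine (Finset.abs_sum_le_sum_abs _ _).trans ?_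
    calc ∑ p ∈ (Finset.Ioc M (2 * M) ×ˢ Finset.Ioc M (2 * M)).filter
            (fun p : ℕ × ℕ => (p.1 : ℤ) - p.2 = k * (j : ℤ)),
            |(liouville (Int.toNat ((p.1 : ℤ) * n + c)) : ℝ) *
              (liouville (Int.toNat ((p.2 : ℤ) * n' + c)) : ℝ)|
          ≤ ∑ p ∈ (Finset.Ioc M (2 * M) ×ˢ Finset.Ioc M (2 * M)).filter
              (fun p : ℕ × ℕ => (p.1 : ℤ) - p.2 = k * (j : ℤ)), (1 : ℝ) := by
            refine Finset.sum_le_sum fun p _ => ?_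
            rw [abs_mul]
            exact mul_le_one₀ (abs_liouville_cast_le_one _) (abs_nonneg _)
              (abs_liouville_cast_le_one _)
      _ ≤ ∑ p ∈ Finset.Ioc M (2 * M) ×ˢ Finset.Ioc M (2 * M), (1 : ℝ) :=
            Finset.sum_le_sum_of_subset_of_nonneg (Finset.filter_subset _ _)
              (fun _ _ _ => zero_le_one)
      _ = (M : ℝ) ^ 2 := by
            rw [Finset.sum_const, Finset.card_product, Nat.card_Ioc, nsmul_eq_mul, mul_one]
            have : 2 * M - M = M := by omega
            rw [this]; push_cast; ring
  calc ∑ j ∈ Finset.Ico (Nat.sqrt M + 1) (2 * (Nat.sqrt M + 1)),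
          |∑ p ∈ (Finset.Ioc M (2 * M) ×ˢ Finset.Ioc M (2 * M)).filter
              (fun p : ℕ × ℕ => (p.1 : ℤ) - p.2 = k * (j : ℤ)),
            (liouville (Int.toNat ((p.1 : ℤ) * n + c)) : ℝ) *
              (liouville (Int.toNat ((p.2 : ℤ) * n' + c)) : ℝ)|
        ≤ ∑ j ∈ Finset.Ico (Nat.sqrt M + 1) (2 * (Nat.sqrt M + 1)), (M : ℝ) ^ 2 :=
          Finset.sum_le_sum hinner
    _ = ((Nat.sqrt M + 1 : ℕ) : ℝ) * (M : ℝ) ^ 2 := by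
          rw [Finset.sum_const, Nat.card_Ico, nsmul_eq_mul]
          have : 2 * (Nat.sqrt M + 1) - (Nat.sqrt M + 1) = Nat.sqrt M + 1 := by omega
          rw [this]

/-- Comparison of the two power bounds used in the assembly. -/
theorem const_rpow_le {C₁ C M e₁ e : ℝ} (hM : 1 ≤ M) (hC : C₁ ≤ C) (hC0 : 0 ≤ C) (he : e₁ ≤ e) :
    C₁ * M ^ e₁ ≤ C * M ^ e := by
  have hpow : M ^ e₁ ≤ M ^ e := Real.rpow_le_rpow_of_exponent_le hM he
  have h0 : 0 ≤ M ^ e₁ := Real.rpow_nonneg (by linarith) _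
  have h0' : 0 ≤ M ^ e := Real.rpow_nonneg (by linarith) _
  rcases le_or_gt C₁ 0 with hC1 | hC1
  · calc C₁ * M ^ e₁ ≤ 0 := by nlinarith
      _ ≤ C * M ^ e := mul_nonneg hC0 h0'
  · calc C₁ * M ^ e₁ ≤ C₁ * M ^ e := mul_le_mul_of_nonneg_left hpow hC1.le
      _ ≤ C * M ^ e := mul_le_mul_of_nonneg_right hC h0'

/-- PROVED: the card's transfer `C⁺ ⟹ FanDecorrelation` is pure bookkeeping. -/
theorem fanFromLaws_holds : FanFromLaws := by
  intro hRS hNeg hEmpty δ hδ hLW hWC c hc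
  obtain ⟨κ, hκ, C₁, h₁⟩ := hLW c hc
  obtain ⟨ϑ₂, hϑ₂, C₂, h₂⟩ := hWC c hc
  set ϑ : ℝ := max (max ϑ₂ (1 / 4 - κ)) 0 with hϑdef
  have hϑlt : ϑ < 1 / 4 := by
    simp only [hϑdef, max_lt_iff]; exact ⟨⟨hϑ₂, by linarith⟩, by norm_num⟩
  have hϑ0 : 0 ≤ ϑ := le_max_right _ _
  have hϑ2le : 3 / 4 + ϑ₂ ≤ 3 / 4 + ϑ := by
    have : ϑ₂ ≤ ϑ := (le_max_left _ _).trans (le_max_left _ _); linarith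
  have hκle : 1 - κ ≤ 3 / 4 + ϑ := by
    have : 1 / 4 - κ ≤ ϑ := (le_max_right _ _).trans (le_max_left _ _); linarith
  set C : ℝ := max (max C₁ C₂) 512 with hCdef
  have hC0 : (0 : ℝ) ≤ C := le_trans (by norm_num) (le_max_right _ _)
  have hC1 : C₁ ≤ C := (le_max_left _ _).trans (le_max_left _ _)
  have hC2 : C₂ ≤ C := (le_max_right _ _).trans (le_max_left _ _)
  refine ⟨ϑ, hϑlt, C, ?_⟩
  -- the claim for `k ≥ 1`, symmetric in `(n, n')`
  have key : ∀ M n n' k : ℕ, 1 ≤ n → 1 ≤ n' → n ≠ n' → n ≤ 2 * M → n' ≤ 2 * M → 1 ≤ k →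
      |fanSum c n n' M k| ≤ C * (M : ℝ) ^ (3 / 4 + ϑ) := by
    intro M n n' k hn hn' hnn' hnM hn'M hk
    have hMpos : 1 ≤ M := by omega
    have hM1 : (1 : ℝ) ≤ M := by exact_mod_cast hMpos
    have hMe : (1 : ℝ) ≤ (M : ℝ) ^ (3 / 4 + ϑ) := Real.one_le_rpow hM1 (by linarith)
    by_cases hM8 : M < 8
    · -- small `M`: trivial bound
      have hs : Nat.sqrt M < 3 := Nat.sqrt_lt'.mpr (by omega)
      calc |fanSum c n n' M k| ≤ ((Nat.sqrt M + 1 : ℕ) : ℝ) * (M : ℝ) ^ 2 := abs_fanSum_le _ _ _ _ _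
        _ ≤ 3 * (7 : ℝ) ^ 2 := by
            refine mul_le_mul ?_ ?_ (by positivity) (by norm_num)
            · exact_mod_cast (show Nat.sqrt M + 1 ≤ 3 by omega)
            · exact pow_le_pow_left₀ (by positivity) (by exact_mod_cast (show M ≤ 7 by omega)) 2
        _ ≤ C := le_trans (by norm_num) (le_max_right _ _)
        _ ≤ C * (M : ℝ) ^ (3 / 4 + ϑ) := le_mul_of_one_le_right hC0 hMe
    · push Not at hM8
      by_cases hsmall : (k : ℝ) ≤ (M : ℝ) ^ (1 / 2 - δ)
      · -- regime I: residue classes one at a time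
        have hkM : k ≤ M := by
          have h' : (M : ℝ) ^ (1 / 2 - δ) ≤ (M : ℝ) ^ (1 : ℝ) :=
            Real.rpow_le_rpow_of_exponent_le hM1 (by linarith)
          rw [Real.rpow_one] at h'
          exact_mod_cast hsmall.trans h'
        rw [hRS c n n' M k hk hkM]
        have hkR : (k : ℝ) ≠ 0 := by exact_mod_cast (show k ≠ 0 by omega)
        calc |∑ r ∈ Finset.range k, windowSum (rowSeq c n k r) (rowSeq c n' k r)
                ((M - r) / k) ((2 * M - r) / k) (Nat.sqrt M + 1) (2 * (Nat.sqrt M + 1))|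
            ≤ ∑ r ∈ Finset.range k, |windowSum (rowSeq c n k r) (rowSeq c n' k r)
                ((M - r) / k) ((2 * M - r) / k) (Nat.sqrt M + 1) (2 * (Nat.sqrt M + 1))| :=
              Finset.abs_sum_le_sum_abs _ _
          _ ≤ ∑ r ∈ Finset.range k, C₁ * (M : ℝ) ^ (1 - κ) / k :=
              Finset.sum_le_sum fun r hr =>
                h₁ M n n' k r hn hn' hnn' hnM hn'M hk hsmall (Finset.mem_range.mp hr)
          _ = C₁ * (M : ℝ) ^ (1 - κ) := by
              rw [Finset.sum_const, Finset.card_range, nsmul_eq_mul]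
              field_simp
          _ ≤ C * (M : ℝ) ^ (3 / 4 + ϑ) := const_rpow_le hM1 hC1 hC0 hκle
      · -- regime II (windowed coset law) or empty fan
        push Not at hsmall
        by_cases hbig : (2 * (Nat.sqrt M + 1) : ℤ) ≤ (k : ℤ)
        · rw [hEmpty c n n' M k hbig, abs_zero]
          exact mul_nonneg hC0 (le_trans zero_le_one hMe)
        · push Not at hbig
          have hk2Q : k < 2 * (Nat.sqrt M + 1) := by exact_mod_cast hbig
          have hsq := Nat.sqrt_le M
          have hkM : k ≤ M := by
            rcases le_or_gt 3 (Nat.sqrt M) with h3 | h3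
            · nlinarith
            · omega
          rw [hRS c n n' M k hk hkM]
          exact (h₂ M n n' k _ _ hn hn' hnn' hnM hn'M hsmall.le hk2Q).trans
            (const_rpow_le hM1 hC2 hC0 hϑ2le)
  -- all `k ≠ 0`
  intro M n n' k hn hn' hnn' hnM hn'M hk0
  show |fanSum c n n' M k| ≤ C * (M : ℝ) ^ (3 / 4 + ϑ)
  rcases lt_or_gt_of_ne hk0 with hneg | hpos
  · obtain ⟨k', hk'⟩ : ∃ k' : ℕ, k = -(k' : ℤ) := ⟨k.natAbs, by omega⟩
    have hk'1 : 1 ≤ k' := by omega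
    rw [hk', hNeg c n n' M (k' : ℤ)]
    exact key M n' n k' hn' hn hnn'.symm hn'M hnM hk'1
  · obtain ⟨k', hk'⟩ : ∃ k' : ℕ, k = (k' : ℤ) := ⟨k.natAbs, by omega⟩
    have hk'1 : 1 ≤ k' := by omega
    rw [hk']
    exact key M n n' k' hn hn' hnn' hnM hn'M hk'1

/-- Hence, with the PROVED bookkeeping discharged: the two laws (one `δ`) imply the crux. -/
theorem fanDecorrelation_of_laws (δ : ℝ) (hδ : 0 < δ) (hLW : LagWindowLaw δ)
    (hWC : WindowedCosetLaw δ) : FanDecorrelation :=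
  fanFromLaws_holds residueSplitting_holds fanSumNeg_holds fanEmptyLargeK_holds δ hδ hLW hWC

end AssemblyProof

/-! ### Proof of `CosetFromLaw` (the sibling crux from the same windowed coset law) -/

section CosetAssemblyProof

open ArithmeticFunction

/-- Trivial bound `|T_j| ≤ M²`. -/
theorem abs_cosetSum_le (c : ℤ) (n n' M j : ℕ) : |cosetSum c n n' M j| ≤ (M : ℝ) ^ 2 := by
  unfold cosetSum
  refine (Finset.abs_sum_le_sum_abs _ _).trans ?_
  calc ∑ p ∈ (Finset.Ioc M (2 * M) ×ˢ Finset.Ioc M (2 * M)).filter (fun p : ℕ × ℕ => p.1 ≡ p.2 [MOD j]),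
          |(liouville (Int.toNat ((p.1 : ℤ) * n + c)) : ℝ) *
            (liouville (Int.toNat ((p.2 : ℤ) * n' + c)) : ℝ)|
        ≤ ∑ p ∈ (Finset.Ioc M (2 * M) ×ˢ Finset.Ioc M (2 * M)).filter
            (fun p : ℕ × ℕ => p.1 ≡ p.2 [MOD j]), (1 : ℝ) := by
          refine Finset.sum_le_sum fun p _ => ?_
          rw [abs_mul]
          exact mul_le_one₀ (abs_liouville_cast_le_one _) (abs_nonneg _)
            (abs_liouville_cast_le_one _)
    _ ≤ ∑ p ∈ Finset.Ioc M (2 * M) ×ˢ Finset.Ioc M (2 * M), (1 : ℝ) :=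
          Finset.sum_le_sum_of_subset_of_nonneg (Finset.filter_subset _ _)
            (fun _ _ _ => zero_le_one)
    _ = (M : ℝ) ^ 2 := by
          rw [Finset.sum_const, Finset.card_product, Nat.card_Ioc, nsmul_eq_mul, mul_one]
          have : 2 * M - M = M := by omega
          rw [this]; push_cast; ring

/-- `M^{1/2−δ} ≤ ⌊√M⌋ + 1 ≤ j` for the coset moduli. -/
theorem rpow_half_sub_le_of_sqrt_lt {M j : ℕ} {δ : ℝ} (hδ : 0 < δ) (hM : 1 ≤ M)
    (hj : Nat.sqrt M + 1 ≤ j) : (M : ℝ) ^ (1 / 2 - δ) ≤ (j : ℝ) := by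
  have hM1 : (1 : ℝ) ≤ M := by exact_mod_cast hM
  have h1 : (M : ℝ) ^ (1 / 2 - δ) ≤ (M : ℝ) ^ (1 / 2 : ℝ) :=
    Real.rpow_le_rpow_of_exponent_le hM1 (by linarith)
  have h2 : (M : ℝ) ^ (1 / 2 : ℝ) = Real.sqrt M := (Real.sqrt_eq_rpow (M : ℝ)).symm
  have h3 : Real.sqrt (M : ℝ) < ((Nat.sqrt M + 1 : ℕ) : ℝ) := by
    rw [Real.sqrt_lt' (by positivity)]
    exact_mod_cast Nat.lt_succ_sqrt' M
  have h4 : ((Nat.sqrt M + 1 : ℕ) : ℝ) ≤ (j : ℝ) := by exact_mod_cast hj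
  linarith

/-- PROVED: the windowed coset law (any `δ > 0`) gives `CosetDecorrelation` (13317) by bookkeeping. -/
theorem cosetFromLaw_holds : CosetFromLaw := by
  intro hCRS δ hδ hWC c hc
  obtain ⟨ϑ₂, hϑ₂, C₂, h₂⟩ := hWC c hc
  set ϑ : ℝ := max ϑ₂ 0 with hϑdef
  have hϑlt : ϑ < 1 / 4 := max_lt hϑ₂ (by norm_num)
  have hϑ0 : 0 ≤ ϑ := le_max_right _ _
  have hϑ2le : 3 / 4 + ϑ₂ ≤ 3 / 4 + ϑ := by have := le_max_left ϑ₂ 0; linarith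
  set C : ℝ := max C₂ 64 with hCdef
  have hC0 : (0 : ℝ) ≤ C := le_trans (by norm_num) (le_max_right _ _)
  have hC2 : C₂ ≤ C := le_max_left _ _
  refine ⟨ϑ, hϑlt, C, ?_⟩
  intro M n n' j hn hn' hnn' hnM hn'M hjlo hjhi
  show |cosetSum c n n' M j| ≤ C * (M : ℝ) ^ (3 / 4 + ϑ)
  have hMpos : 1 ≤ M := by omega
  have hM1 : (1 : ℝ) ≤ M := by exact_mod_cast hMpos
  have hMe : (1 : ℝ) ≤ (M : ℝ) ^ (3 / 4 + ϑ) := Real.one_le_rpow hM1 (by linarith)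
  by_cases hM8 : M < 8
  · calc |cosetSum c n n' M j| ≤ (M : ℝ) ^ 2 := abs_cosetSum_le _ _ _ _ _
      _ ≤ (7 : ℝ) ^ 2 := pow_le_pow_left₀ (by positivity) (by exact_mod_cast (show M ≤ 7 by omega)) 2
      _ ≤ C := le_trans (by norm_num) (le_max_right _ _)
      _ ≤ C * (M : ℝ) ^ (3 / 4 + ϑ) := le_mul_of_one_le_right hC0 hMe
  · push Not at hM8
    have hj1 : 1 ≤ j := by omega
    have hsq := Nat.sqrt_le M
    have hjM : j ≤ M := by
      rcases le_or_gt 3 (Nat.sqrt M) with h3 | h3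
      · nlinarith
      · omega
    rw [hCRS c n n' M j hj1 hjM]
    exact (h₂ M n n' j _ _ hn hn' hnn' hnM hn'M (rpow_half_sub_le_of_sqrt_lt hδ hMpos hjlo) hjhi).trans
      (const_rpow_le hM1 hC2 hC0 hϑ2le)

end CosetAssemblyProof

/-! ### Proof of `CosetResidueSplitting` and the full `MADFromLaws` -/

section CosetSplittingProof

open ArithmeticFunction

/-- PROVED: the residue reindexing for cosets (`T_q = Σ_{r<q} Σ_{all lags} α_r(y) β_r(y')`). -/
theorem cosetResidueSplitting_holds : CosetResidueSplitting := by
  intro c n n' M q hq hqM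
  have hq0 : 0 < q := hq
  have hqz : (q : ℤ) ≠ 0 := by exact_mod_cast (show q ≠ 0 by omega)
  set box : Finset ℕ := Finset.Ioc M (2 * M) with hbox
  set g : ℕ × ℕ → ℝ := fun p =>
    (liouville (Int.toNat ((p.1 : ℤ) * n + c)) : ℝ) *
      (liouville (Int.toNat ((p.2 : ℤ) * n' + c)) : ℝ) with hg
  have hA : cosetSum c n n' M q =
      ∑ p ∈ (box ×ˢ box).filter (fun p : ℕ × ℕ => p.1 ≡ p.2 [MOD q]), g p := rfl
  set big : Finset (ℕ × ℕ) := Finset.Ioc 0 (2 * M) ×ˢ Finset.Ioc 0 (2 * M) with hbig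
  set P : ℕ × (ℕ × ℕ) → Prop := fun x =>
    (x.2.1 ∈ Finset.Ioc ((M - x.1) / q) ((2 * M - x.1) / q) ∧
      x.2.2 ∈ Finset.Ioc ((M - x.1) / q) ((2 * M - x.1) / q)) ∧
    (-(M : ℤ) ≤ (x.2.1 : ℤ) - x.2.2 ∧ (x.2.1 : ℤ) - x.2.2 < (M : ℤ) + 1) with hP
  set f : ℕ × (ℕ × ℕ) → ℝ := fun x => rowSeq c n q x.1 x.2.1 * rowSeq c n' q x.1 x.2.2 with hf
  have hB : (∑ r ∈ Finset.range q,
      windowSum (rowSeq c n q r) (rowSeq c n' q r) ((M - r) / q) ((2 * M - r) / q)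
        (-(M : ℤ)) ((M : ℤ) + 1)) =
        ∑ x ∈ (Finset.range q ×ˢ big).filter P, f x := by
    rw [Finset.sum_filter, Finset.sum_product]
    refine Finset.sum_congr rfl fun r hr => ?_
    unfold windowSum
    rw [Finset.sum_filter]
    have hsub : Finset.Ioc ((M - r) / q) ((2 * M - r) / q) ⊆ Finset.Ioc 0 (2 * M) := by
      intro y hy
      rw [Finset.mem_Ioc] at hy ⊢
      refine ⟨lt_of_le_of_lt (Nat.zero_le _) hy.1, le_trans hy.2 (Nat.div_le_self _ _ |>.trans (Nat.sub_le _ _))⟩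
    symm
    rw [← Finset.sum_subset (Finset.product_subset_product hsub hsub)]
    · refine Finset.sum_congr rfl fun p hp => ?_
      rw [Finset.mem_product] at hp
      simp only [hf]
      by_cases hw : -(M : ℤ) ≤ (p.1 : ℤ) - p.2 ∧ (p.1 : ℤ) - p.2 < (M : ℤ) + 1
      · rw [if_pos ⟨hp, hw⟩, if_pos hw]
      · rw [if_neg (fun h => hw h.2), if_neg hw]
    · intro p _ hp
      rw [if_neg]
      intro hPq
      exact hp (Finset.mem_product.mpr hPq.1)
  rw [hA, hB]
  symm
  refine Finset.sum_nbij' (fun x => (q * x.2.1 + x.1, q * x.2.2 + x.1))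
    (fun p => (p.1 % q, (p.1 / q, p.2 / q))) ?_ ?_ ?_ ?_ ?_
  · intro x hx
    rw [Finset.mem_filter, Finset.mem_product, Finset.mem_range] at hx
    obtain ⟨⟨hr, _⟩, ⟨hy, hy'⟩, _, _⟩ := hx
    rw [Finset.mem_Ioc] at hy hy'
    have hrM : x.1 ≤ M := by omega
    rw [Finset.mem_filter, Finset.mem_product, hbox, Finset.mem_Ioc, Finset.mem_Ioc]
    have h1 : M - x.1 < x.2.1 * q := (Nat.div_lt_iff_lt_mul hq0).mp hy.1
    have h2 : x.2.1 * q ≤ 2 * M - x.1 := (Nat.le_div_iff_mul_le hq0).mp hy.2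
    have h3 : M - x.1 < x.2.2 * q := (Nat.div_lt_iff_lt_mul hq0).mp hy'.1
    have h4 : x.2.2 * q ≤ 2 * M - x.1 := (Nat.le_div_iff_mul_le hq0).mp hy'.2
    have h1' : M < x.2.1 * q + x.1 := (tsub_lt_iff_right hrM).mp h1
    have h2' : x.2.1 * q + x.1 ≤ 2 * M := (Nat.le_sub_iff_add_le (by omega)).mp h2
    have h3' : M < x.2.2 * q + x.1 := (tsub_lt_iff_right hrM).mp h3
    have h4' : x.2.2 * q + x.1 ≤ 2 * M := (Nat.le_sub_iff_add_le (by omega)).mp h4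
    refine ⟨⟨⟨?_, ?_⟩, ⟨?_, ?_⟩⟩, ?_⟩
    · show M < q * x.2.1 + x.1; linarith [mul_comm q x.2.1]
    · show q * x.2.1 + x.1 ≤ 2 * M; linarith [mul_comm q x.2.1]
    · show M < q * x.2.2 + x.1; linarith [mul_comm q x.2.2]
    · show q * x.2.2 + x.1 ≤ 2 * M; linarith [mul_comm q x.2.2]
    · show (q * x.2.1 + x.1) % q = (q * x.2.2 + x.1) % q
      rw [Nat.mul_add_mod, Nat.mul_add_mod]
  · intro p hp
    rw [Finset.mem_filter, Finset.mem_product, hbox, Finset.mem_Ioc, Finset.mem_Ioc] at hp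
    obtain ⟨⟨⟨h1, h2⟩, ⟨h3, h4⟩⟩, hmod'⟩ := hp
    have hmod : p.2 % q = p.1 % q := Nat.ModEq.symm hmod'
    have e2' : q * (p.2 / q) + p.1 % q = p.2 := by rw [← hmod]; exact Nat.div_add_mod p.2 q
    set y := p.1 / q with hy
    set y' := p.2 / q with hy'
    set r := p.1 % q with hr
    have e1 : q * y + r = p.1 := Nat.div_add_mod p.1 q
    have e2 : q * y' + r = p.2 := e2'
    have hlt : r < q := Nat.mod_lt _ hq0
    have hrM : r ≤ M := by omega
    rw [Finset.mem_filter, Finset.mem_product, Finset.mem_range]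
    simp only [hP, hbig, Finset.mem_product, Finset.mem_Ioc]
    have hy0 : 0 < y := Nat.pos_of_ne_zero fun h0 => by
      rw [h0, mul_zero, zero_add] at e1; omega
    have hy0' : 0 < y' := Nat.pos_of_ne_zero fun h0 => by
      rw [h0, mul_zero, zero_add] at e2; omega
    have hyM : y ≤ 2 * M :=
      calc y ≤ q * y := Nat.le_mul_of_pos_left y hq0
        _ ≤ q * y + r := Nat.le_add_right _ _
        _ = p.1 := e1
        _ ≤ 2 * M := h2
    have hyM' : y' ≤ 2 * M :=
      calc y' ≤ q * y' := Nat.le_mul_of_pos_left y' hq0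
        _ ≤ q * y' + r := Nat.le_add_right _ _
        _ = p.2 := e2
        _ ≤ 2 * M := h4
    -- the lag window is automatic: q (y − y') = p.1 − p.2 ∈ (−M, M)
    have hqd : (q : ℤ) * ((y : ℤ) - y') = (p.1 : ℤ) - p.2 := by
      have a1 : ((p.1 : ℕ) : ℤ) = ((q * y + r : ℕ) : ℤ) := by rw [e1]
      have a2 : ((p.2 : ℕ) : ℤ) = ((q * y' + r : ℕ) : ℤ) := by rw [e2]
      rw [a1, a2]; simp only [Nat.cast_add, Nat.cast_mul]; ring
    have hq1 : (1 : ℤ) ≤ q := by exact_mod_cast hq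
    have hd1 : (p.1 : ℤ) - p.2 ≤ (M : ℤ) - 1 := by
      have : (p.1 : ℤ) ≤ 2 * (M : ℤ) := by exact_mod_cast h2
      have : (M : ℤ) + 1 ≤ p.2 := by exact_mod_cast h3
      linarith
    have hd2 : 1 - (M : ℤ) ≤ (p.1 : ℤ) - p.2 := by
      have : (p.2 : ℤ) ≤ 2 * (M : ℤ) := by exact_mod_cast h4
      have : (M : ℤ) + 1 ≤ p.1 := by exact_mod_cast h1
      linarith
    have hw1 : -(M : ℤ) ≤ (y : ℤ) - y' := by
      by_contra hcon
      push Not at hcon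
      have hneg : (y : ℤ) - y' ≤ -1 := by linarith
      nlinarith
    have hw2 : (y : ℤ) - y' < (M : ℤ) + 1 := by
      by_contra hcon
      push Not at hcon
      nlinarith
    refine ⟨⟨hlt, ⟨hy0, hyM⟩, ⟨hy0', hyM'⟩⟩, ⟨⟨?_, ?_⟩, ⟨?_, ?_⟩⟩, hw1, hw2⟩
    · rw [Nat.div_lt_iff_lt_mul hq0, mul_comm]
      exact (tsub_lt_iff_right hrM).mpr (by rw [e1]; exact h1)
    · rw [Nat.le_div_iff_mul_le hq0, mul_comm]
      exact (Nat.le_sub_iff_add_le (by omega)).mpr (by rw [e1]; exact h2)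
    · rw [Nat.div_lt_iff_lt_mul hq0, mul_comm]
      exact (tsub_lt_iff_right hrM).mpr (by rw [e2]; exact h3)
    · rw [Nat.le_div_iff_mul_le hq0, mul_comm]
      exact (Nat.le_sub_iff_add_le (by omega)).mpr (by rw [e2]; exact h4)
  · intro x hx
    rw [Finset.mem_filter, Finset.mem_product, Finset.mem_range] at hx
    obtain ⟨⟨hr, _⟩, _⟩ := hx
    ext
    · show (q * x.2.1 + x.1) % q = x.1
      rw [Nat.mul_add_mod, Nat.mod_eq_of_lt hr]
    · show (q * x.2.1 + x.1) / q = x.2.1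
      rw [Nat.mul_add_div hq0, Nat.div_eq_of_lt hr, add_zero]
    · show (q * x.2.2 + x.1) / q = x.2.2
      rw [Nat.mul_add_div hq0, Nat.div_eq_of_lt hr, add_zero]
  · intro p hp
    rw [Finset.mem_filter] at hp
    obtain ⟨_, hmod'⟩ := hp
    have hmod : p.2 % q = p.1 % q := Nat.ModEq.symm hmod'
    ext
    · show q * (p.1 / q) + p.1 % q = p.1
      exact Nat.div_add_mod p.1 q
    · show q * (p.2 / q) + p.1 % q = p.2
      rw [← hmod]; exact Nat.div_add_mod p.2 q
  · intro x _
    simp only [hf, hg, rowSeq, Nat.cast_add, Nat.cast_mul]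

/-- PROVED: `MADFromLaws` — both decorrelation cruxes of LiouvilleMAD from `C⁺`. -/
theorem madFromLaws_holds : MADFromLaws :=
  fun hRS hNeg hEmpty hCRS δ hδ hLW hWC =>
    ⟨cosetFromLaw_holds hCRS δ hδ hWC, fanFromLaws_holds hRS hNeg hEmpty δ hδ hLW hWC⟩

/-- Hence, all bookkeeping discharged: for any `δ > 0`, `LagWindowLaw δ ∧ WindowedCosetLaw δ ⟹ MAD`. -/
theorem mad_of_laws (δ : ℝ) (hδ : 0 < δ) (hLW : LagWindowLaw δ) (hWC : WindowedCosetLaw δ) :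
    CosetDecorrelation ∧ FanDecorrelation :=
  madFromLaws_holds residueSplitting_holds fanSumNeg_holds fanEmptyLargeK_holds
    cosetResidueSplitting_holds δ hδ hLW hWC

end CosetSplittingProof

/-! ### Proof of `SameModulus` -/

section SameModulusProof

open ArithmeticFunction

/-- PROVED: the same-modulus normal form. -/
theorem sameModulus_holds : SameModulus := by
  intro c n n' M k hn hn'
  unfold fanSum
  rw [Finset.mul_sum]
  refine Finset.sum_congr rfl fun j _ => ?_
  rw [Finset.mul_sum]
  refine Finset.sum_congr rfl fun p _ => ?_
  have e1 : ((n * n' : ℕ) : ℤ) * (p.1 : ℤ) + (n' : ℤ) * c = (n' : ℤ) * ((p.1 : ℤ) * n + c) := by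
    push_cast; ring
  have e2 : ((n * n' : ℕ) : ℤ) * (p.2 : ℤ) + (n : ℤ) * c = (n : ℤ) * ((p.2 : ℤ) * n' + c) := by
    push_cast; ring
  rw [e1, e2, liouville_toNat_mul n' hn', liouville_toNat_mul n hn,
    liouville_mul_of_ne_zero (show n ≠ 0 by omega) (show n' ≠ 0 by omega)]
  push_cast
  set A : ℝ := (liouville (Int.toNat ((p.1 : ℤ) * n + c)) : ℝ)
  set B : ℝ := (liouville (Int.toNat ((p.2 : ℤ) * n' + c)) : ℝ)
  set x : ℝ := (liouville n : ℝ)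
  set y : ℝ := (liouville n' : ℝ)
  have h1 : x * x = 1 := liouville_sq_cast (t := n) (by omega)
  have h2 : y * y = 1 := liouville_sq_cast (t := n') (by omega)
  linear_combination (-(A * B * y * y)) * h1 + (-(A * B)) * h2

end SameModulusProof

/-! ### Proof of `MADFromNoise` (the umbrella law gives both cruxes) -/

section NoiseProof

open ArithmeticFunction

/-- Integer-range version of `sum_Ico_ite_eq_mul`. -/
theorem sum_IcoInt_ite_eq_mul (d : ℤ) (j : ℕ) (hj : 1 ≤ j) (A B : ℤ) (x : ℝ) :
    (∑ i ∈ Finset.Ico A B, if d = (j : ℤ) * i then x else 0) =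
      if ((j : ℤ) ∣ d ∧ A ≤ d / j ∧ d / j < B) then x else 0 := by
  have hj0 : (j : ℤ) ≠ 0 := by exact_mod_cast (show j ≠ 0 by omega)
  by_cases h : ((j : ℤ) ∣ d ∧ A ≤ d / j ∧ d / j < B)
  · rw [if_pos h]
    obtain ⟨hdvd, hlo, hhi⟩ := h
    have hmem : d / j ∈ Finset.Ico A B := Finset.mem_Ico.mpr ⟨hlo, hhi⟩
    rw [Finset.sum_eq_single_of_mem (d / j) hmem]
    · rw [if_pos]; exact (Int.mul_ediv_cancel' hdvd).symm
    · intro i _ hne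
      rw [if_neg]
      intro heq
      apply hne
      rw [heq, Int.mul_ediv_cancel_left _ hj0]
  · rw [if_neg h]
    refine Finset.sum_eq_zero fun i hi => ?_
    rw [if_neg]
    intro heq
    apply h
    rw [Finset.mem_Ico] at hi
    have hq : d / j = i := by rw [heq, Int.mul_ediv_cancel_left _ hj0]
    exact ⟨⟨i, heq⟩, hq ▸ hi.1, hq ▸ hi.2⟩

/-- The coset sum as a window of ALL lags of the decimated correlation sequence:
`T_j = Σ_{|i| ≤ (M−1)/j} D(j i)`. -/
theorem cosetSum_eq_sum_lagCorr (c : ℤ) (n n' M j : ℕ) (hj : 1 ≤ j) :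
    cosetSum c n n' M j =
      ∑ i ∈ Finset.Ico (-(((M - 1) / j : ℕ) : ℤ)) ((((M - 1) / j : ℕ) : ℤ) + 1),
        lagCorr c n n' M ((j : ℤ) * i) := by
  have hj0 : 0 < j := hj
  set B : ℕ := (M - 1) / j with hB
  set box : Finset ℕ := Finset.Ioc M (2 * M) with hbox
  set g : ℕ × ℕ → ℝ := fun p =>
    (liouville (Int.toNat ((p.1 : ℤ) * n + c)) : ℝ) *
      (liouville (Int.toNat ((p.2 : ℤ) * n' + c)) : ℝ) with hg
  -- right-hand side as one filtered sum over the box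
  have hR : (∑ i ∈ Finset.Ico (-(B : ℤ)) ((B : ℤ) + 1), lagCorr c n n' M ((j : ℤ) * i)) =
      ∑ p ∈ box ×ˢ box, if ((j : ℤ) ∣ ((p.1 : ℤ) - p.2) ∧ (-(B : ℤ)) ≤ ((p.1 : ℤ) - p.2) / j ∧
          ((p.1 : ℤ) - p.2) / j < (B : ℤ) + 1) then g p else 0 := by
    unfold lagCorr
    have : ∀ i ∈ Finset.Ico (-(B : ℤ)) ((B : ℤ) + 1),
        (∑ p ∈ (box ×ˢ box).filter (fun p : ℕ × ℕ => (p.1 : ℤ) - p.2 = (j : ℤ) * i), g p) =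
          ∑ p ∈ box ×ˢ box, if (p.1 : ℤ) - p.2 = (j : ℤ) * i then g p else 0 := by
      intro i _; rw [Finset.sum_filter]
    rw [Finset.sum_congr rfl this, Finset.sum_comm]
    refine Finset.sum_congr rfl fun p _ => ?_
    exact sum_IcoInt_ite_eq_mul ((p.1 : ℤ) - p.2) j hj _ _ (g p)
  rw [hR]
  unfold cosetSum
  rw [Finset.sum_filter]
  refine Finset.sum_congr rfl fun p hp => ?_
  rw [Finset.mem_product, hbox, Finset.mem_Ioc, Finset.mem_Ioc] at hp
  obtain ⟨⟨h1, h2⟩, ⟨h3, h4⟩⟩ := hp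
  -- the two conditions agree on the box
  have hiff : (p.1 ≡ p.2 [MOD j]) ↔ ((j : ℤ) ∣ ((p.1 : ℤ) - p.2) ∧ (-(B : ℤ)) ≤ ((p.1 : ℤ) - p.2) / j ∧
      ((p.1 : ℤ) - p.2) / j < (B : ℤ) + 1) := by
    constructor
    · intro hmod
      have hdvd : (j : ℤ) ∣ ((p.1 : ℤ) - p.2) := (Nat.modEq_iff_dvd.mp hmod.symm)
      obtain ⟨q, hq⟩ := hdvd
      have hjz : (j : ℤ) ≠ 0 := by exact_mod_cast (show j ≠ 0 by omega)
      have hqd : ((p.1 : ℤ) - p.2) / j = q := by rw [hq, Int.mul_ediv_cancel_left _ hjz]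
      refine ⟨⟨q, hq⟩, ?_, ?_⟩
      · rw [hqd]
        -- |q| * j = |p.1 - p.2| ≤ M - 1  ⟹  |q| ≤ B
        have habs : q.natAbs * j ≤ M - 1 := by
          have e : ((q.natAbs * j : ℕ) : ℤ) = |(p.1 : ℤ) - p.2| := by
            rw [hq, abs_mul, Nat.cast_mul, Int.natCast_natAbs, mul_comm]
            simp
          have : |(p.1 : ℤ) - p.2| ≤ ((M - 1 : ℕ) : ℤ) := by
            rw [abs_le]; constructor <;> omega
          exact_mod_cast e ▸ this
        have hqB : q.natAbs ≤ B := (Nat.le_div_iff_mul_le hj0).mpr habs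
        omega
      · rw [hqd]
        have habs : q.natAbs * j ≤ M - 1 := by
          have e : ((q.natAbs * j : ℕ) : ℤ) = |(p.1 : ℤ) - p.2| := by
            rw [hq, abs_mul, Nat.cast_mul, Int.natCast_natAbs, mul_comm]
            simp
          have : |(p.1 : ℤ) - p.2| ≤ ((M - 1 : ℕ) : ℤ) := by
            rw [abs_le]; constructor <;> omega
          exact_mod_cast e ▸ this
        have hqB : q.natAbs ≤ B := (Nat.le_div_iff_mul_le hj0).mpr habs
        omega
    · rintro ⟨hdvd, _, _⟩
      exact (Nat.modEq_iff_dvd.mpr hdvd).symm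
  by_cases hc : p.1 ≡ p.2 [MOD j]
  · rw [if_pos hc, if_pos (hiff.mp hc)]
  · rw [if_neg hc, if_neg (fun h => hc (hiff.mpr h))]

/-- The real sum inside the noise law at `θ = 0`. -/
theorem norm_noise_sum_zero (x : ℤ → ℝ) (S : Finset ℤ) :
    ‖∑ i ∈ S, (x i : ℂ) * Complex.exp (2 * Real.pi * Complex.I * (0 : ℝ) * i)‖ = |∑ i ∈ S, x i| := by
  have : ∀ i ∈ S, (x i : ℂ) * Complex.exp (2 * Real.pi * Complex.I * (0 : ℝ) * i) = (x i : ℂ) := by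
    intro i _; simp
  rw [Finset.sum_congr rfl this, ← Complex.ofReal_sum, Complex.norm_real, Real.norm_eq_abs]

/-- Threshold arithmetic: for `κ < 1/4` and `M ≥ M₀ = 3^{1/(1/2−2κ)}`, `2√M + 1 ≤ 3√M ≤ M^{1−2κ}`. -/
theorem window_cap_of_large {κ : ℝ} (hκ : 0 < κ) (hκ4 : κ < 1 / 4) {M : ℕ} (hM : 1 ≤ M)
    (hM0 : (3 : ℝ) ^ (1 / (1 / 2 - 2 * κ)) ≤ (M : ℝ)) :
    2 * Real.sqrt M + 1 ≤ (M : ℝ) ^ (1 - 2 * κ) := by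
  have he : 0 < 1 / 2 - 2 * κ := by linarith
  have hM1 : (1 : ℝ) ≤ M := by exact_mod_cast hM
  have hMpos : (0 : ℝ) < M := by linarith
  -- M^{1/2 - 2κ} ≥ 3
  have h3 : (3 : ℝ) ≤ (M : ℝ) ^ (1 / 2 - 2 * κ) := by
    have := Real.rpow_le_rpow (by positivity) hM0 he.le
    rwa [← Real.rpow_mul (by norm_num), one_div_mul_cancel he.ne', Real.rpow_one] at this
  have hsqrt1 : 1 ≤ Real.sqrt M := by rw [Real.le_sqrt (by norm_num) hMpos.le]; simpa using hM1
  have hsplit : (M : ℝ) ^ (1 - 2 * κ) = Real.sqrt M * (M : ℝ) ^ (1 / 2 - 2 * κ) := by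
    rw [Real.sqrt_eq_rpow, ← Real.rpow_add hMpos]; congr 1; ring
  rw [hsplit]
  nlinarith [Real.sqrt_nonneg (M : ℝ)]

/-- PROVED: the umbrella `CorrelationNoiseLaw` gives both cruxes. -/
theorem madFromNoise_holds : MADFromNoise := by
  intro hNeg hEmpty hCNL
  -- common preparation for one shift `c`
  have prep : ∀ c : ℤ, c ≠ 0 → ∃ ϑ : ℝ, ϑ < 1 / 4 ∧ ∃ C : ℝ, 0 ≤ C ∧
      (∀ M n n' j : ℕ, 1 ≤ n → 1 ≤ n' → n ≠ n' → n ≤ 2 * M → n' ≤ 2 * M →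
        Nat.sqrt M + 1 ≤ j → j < 2 * (Nat.sqrt M + 1) → |cosetSum c n n' M j| ≤ C * (M : ℝ) ^ (3 / 4 + ϑ)) ∧
      (∀ M n n' k : ℕ, 1 ≤ n → 1 ≤ n' → n ≠ n' → n ≤ 2 * M → n' ≤ 2 * M → 1 ≤ k →
        |fanSum c n n' M k| ≤ C * (M : ℝ) ^ (3 / 4 + ϑ)) := by
    intro c hc
    obtain ⟨κ, hκ, hκ4, C₀, h₀⟩ := hCNL c hc
    set M₀ : ℝ := (3 : ℝ) ^ (1 / (1 / 2 - 2 * κ)) with hM₀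
    have hM₀0 : 0 ≤ M₀ := by positivity
    set ϑ : ℝ := 1 / 4 - κ with hϑ
    have hϑlt : ϑ < 1 / 4 := by rw [hϑ]; linarith
    have hϑe : 1 - κ = 3 / 4 + ϑ := by rw [hϑ]; ring
    set C : ℝ := max C₀ ((M₀ + 1) ^ 3) with hC
    have hC0 : 0 ≤ C := le_trans (by positivity) (le_max_right _ _)
    have hCC : C₀ ≤ C := le_max_left _ _
    refine ⟨ϑ, hϑlt, C, hC0, ?_, ?_⟩
    · -- cosets
      intro M n n' j hn hn' hnn' hnM hn'M hjlo hjhi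
      have hMpos : 1 ≤ M := by omega
      have hM1 : (1 : ℝ) ≤ M := by exact_mod_cast hMpos
      have hj1 : 1 ≤ j := by omega
      have hMe : (1 : ℝ) ≤ (M : ℝ) ^ (3 / 4 + ϑ) := Real.one_le_rpow hM1 (by linarith)
      by_cases hsmall : (M : ℝ) < M₀
      · calc |cosetSum c n n' M j| ≤ (M : ℝ) ^ 2 := abs_cosetSum_le _ _ _ _ _
          _ ≤ (M₀ + 1) ^ 3 := by
              have hM0' : (M : ℝ) ≤ M₀ + 1 := by linarith
              calc (M : ℝ) ^ 2 ≤ (M₀ + 1) ^ 2 := pow_le_pow_left₀ (by positivity) hM0' 2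
                _ ≤ (M₀ + 1) ^ 3 := pow_le_pow_right₀ (by linarith) (by norm_num)
          _ ≤ C := le_max_right _ _
          _ ≤ C * (M : ℝ) ^ (3 / 4 + ϑ) := le_mul_of_one_le_right hC0 hMe
      · push Not at hsmall
        rw [cosetSum_eq_sum_lagCorr c n n' M j hj1]
        have hcap : (((((M - 1) / j : ℕ) : ℤ) + 1 - (-(((M - 1) / j : ℕ) : ℤ)) : ℤ) : ℝ) ≤
            (M : ℝ) ^ (1 - 2 * κ) := by
          have hB : ((M - 1) / j : ℕ) ≤ (M - 1) / (Nat.sqrt M + 1) := Nat.div_le_div_left hjlo (by omega)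
          have hB2 : (M - 1) / (Nat.sqrt M + 1) ≤ Nat.sqrt M := by
            have hlt : M < (Nat.sqrt M + 1) * (Nat.sqrt M + 1) := Nat.lt_succ_sqrt M
            have : (M - 1) / (Nat.sqrt M + 1) < Nat.sqrt M + 1 :=
              (Nat.div_lt_iff_lt_mul (by omega)).mpr (by omega)
            omega
          have hsq : ((Nat.sqrt M : ℕ) : ℝ) ≤ Real.sqrt M := by
            rw [Real.le_sqrt (by positivity) (by positivity)]
            exact_mod_cast Nat.sqrt_le' M
          have hW := window_cap_of_large hκ hκ4 hMpos hsmall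
          have hBs : ((((M - 1) / j : ℕ) : ℝ)) ≤ Real.sqrt M := by
            calc ((((M - 1) / j : ℕ) : ℝ)) ≤ ((Nat.sqrt M : ℕ) : ℝ) := by exact_mod_cast hB.trans hB2
              _ ≤ Real.sqrt M := hsq
          have e : (((((M - 1) / j : ℕ) : ℤ) + 1 - (-(((M - 1) / j : ℕ) : ℤ)) : ℤ) : ℝ) =
              2 * ((((M - 1) / j : ℕ) : ℝ)) + 1 := by
            simp only [Int.cast_sub, Int.cast_add, Int.cast_neg, Int.cast_one, Int.cast_natCast]; ring
          rw [e]; linarith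
        have := h₀ M n n' j (-(((M - 1) / j : ℕ) : ℤ)) ((((M - 1) / j : ℕ) : ℤ) + 1) 0
          hn hn' hnn' hnM hn'M hj1 hcap
        rw [norm_noise_sum_zero] at this
        calc |∑ i ∈ Finset.Ico (-(((M - 1) / j : ℕ) : ℤ)) ((((M - 1) / j : ℕ) : ℤ) + 1),
              lagCorr c n n' M ((j : ℤ) * i)| ≤ C₀ * (M : ℝ) ^ (1 - κ) := this
          _ ≤ C * (M : ℝ) ^ (3 / 4 + ϑ) := by rw [hϑe]; exact const_rpow_le hM1 hCC hC0 le_rfl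
    · -- fans, `k ≥ 1`
      intro M n n' k hn hn' hnn' hnM hn'M hk
      have hMpos : 1 ≤ M := by omega
      have hM1 : (1 : ℝ) ≤ M := by exact_mod_cast hMpos
      have hMe : (1 : ℝ) ≤ (M : ℝ) ^ (3 / 4 + ϑ) := Real.one_le_rpow hM1 (by linarith)
      by_cases hsmall : (M : ℝ) < M₀
      · calc |fanSum c n n' M k| ≤ ((Nat.sqrt M + 1 : ℕ) : ℝ) * (M : ℝ) ^ 2 := abs_fanSum_le _ _ _ _ _
          _ ≤ (M₀ + 1) ^ 3 := by
              have hM0' : (M : ℝ) ≤ M₀ + 1 := by linarith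
              have hs : ((Nat.sqrt M + 1 : ℕ) : ℝ) ≤ M₀ + 1 := by
                have : Nat.sqrt M ≤ M := Nat.sqrt_le_self M
                have : ((Nat.sqrt M + 1 : ℕ) : ℝ) ≤ (M : ℝ) + 1 := by exact_mod_cast (by omega : Nat.sqrt M + 1 ≤ M + 1)
                linarith
              calc ((Nat.sqrt M + 1 : ℕ) : ℝ) * (M : ℝ) ^ 2 ≤ (M₀ + 1) * (M₀ + 1) ^ 2 :=
                    mul_le_mul hs (pow_le_pow_left₀ (by positivity) hM0' 2) (by positivity) (by linarith)
                _ = (M₀ + 1) ^ 3 := by ring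
          _ ≤ C := le_max_right _ _
          _ ≤ C * (M : ℝ) ^ (3 / 4 + ϑ) := le_mul_of_one_le_right hC0 hMe
      · push Not at hsmall
        rw [fanSum_eq_sum_lagCorr]
        have hcap : ((((2 * (Nat.sqrt M + 1) : ℕ) : ℤ) - ((Nat.sqrt M + 1 : ℕ) : ℤ) : ℤ) : ℝ) ≤
            (M : ℝ) ^ (1 - 2 * κ) := by
          have hsq : ((Nat.sqrt M : ℕ) : ℝ) ≤ Real.sqrt M := by
            rw [Real.le_sqrt (by positivity) (by positivity)]
            exact_mod_cast Nat.sqrt_le' M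
          have hW := window_cap_of_large hκ hκ4 hMpos hsmall
          have hsqrt1 : 1 ≤ Real.sqrt M := by
            rw [Real.le_sqrt (by norm_num) (by positivity)]; simpa using hM1
          have e : ((((2 * (Nat.sqrt M + 1) : ℕ) : ℤ) - ((Nat.sqrt M + 1 : ℕ) : ℤ) : ℤ) : ℝ) =
              ((Nat.sqrt M : ℕ) : ℝ) + 1 := by
            simp only [Int.cast_sub, Int.cast_natCast]; push_cast; ring
          rw [e]; linarith
        have := h₀ M n n' k ((Nat.sqrt M + 1 : ℕ) : ℤ) ((2 * (Nat.sqrt M + 1) : ℕ) : ℤ) 0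
          hn hn' hnn' hnM hn'M hk hcap
        rw [norm_noise_sum_zero] at this
        -- the `ℤ`-indexed window equals the `ℕ`-indexed one of `fanSum_eq_sum_lagCorr`
        have hreindex : (∑ i ∈ Finset.Ico ((Nat.sqrt M + 1 : ℕ) : ℤ) ((2 * (Nat.sqrt M + 1) : ℕ) : ℤ),
            lagCorr c n n' M ((k : ℤ) * i)) =
            ∑ j ∈ Finset.Ico (Nat.sqrt M + 1) (2 * (Nat.sqrt M + 1)), lagCorr c n n' M ((k : ℤ) * (j : ℤ)) := by
          refine Finset.sum_nbij' (fun i : ℤ => i.toNat) (fun j : ℕ => (j : ℤ)) ?_ ?_ ?_ ?_ ?_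
          · intro i hi
            rw [Finset.mem_Ico] at hi ⊢
            have h0 : 0 ≤ i := le_trans (by positivity) hi.1
            have e : ((i.toNat : ℕ) : ℤ) = i := Int.toNat_of_nonneg h0
            constructor <;> omega
          · intro j hj
            rw [Finset.mem_Ico] at hj ⊢
            constructor <;> push_cast <;> omega
          · intro i hi
            rw [Finset.mem_Ico] at hi
            exact Int.toNat_of_nonneg (le_trans (by positivity) hi.1)
          · intro j _
            exact Int.toNat_natCast j
          · intro i hi
            rw [Finset.mem_Ico] at hi
            simp only [Int.toNat_of_nonneg (le_trans (by positivity) hi.1)]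
        rw [hreindex] at this
        calc |∑ j ∈ Finset.Ico (Nat.sqrt M + 1) (2 * (Nat.sqrt M + 1)), lagCorr c n n' M ((k : ℤ) * (j : ℤ))|
              ≤ C₀ * (M : ℝ) ^ (1 - κ) := this
          _ ≤ C * (M : ℝ) ^ (3 / 4 + ϑ) := by rw [hϑe]; exact const_rpow_le hM1 hCC hC0 le_rfl
  constructor
  · -- CosetDecorrelation
    intro c hc
    obtain ⟨ϑ, hϑ, C, _, hcos, _⟩ := prep c hc
    exact ⟨ϑ, hϑ, C, fun M n n' j hn hn' hnn' hnM hn'M hjlo hjhi => hcos M n n' j hn hn' hnn' hnM hn'M hjlo hjhi⟩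
  · -- FanDecorrelation
    intro c hc
    obtain ⟨ϑ, hϑ, C, _, _, hfan⟩ := prep c hc
    refine ⟨ϑ, hϑ, C, ?_⟩
    intro M n n' k hn hn' hnn' hnM hn'M hk0
    show |fanSum c n n' M k| ≤ C * (M : ℝ) ^ (3 / 4 + ϑ)
    rcases lt_or_gt_of_ne hk0 with hneg | hpos
    · obtain ⟨k', hk'⟩ : ∃ k' : ℕ, k = -(k' : ℤ) := ⟨k.natAbs, by omega⟩
      rw [hk', hNeg c n n' M (k' : ℤ)]
      exact hfan M n' n k' hn' hn hnn'.symm hn'M hnM (by omega)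
    · obtain ⟨k', hk'⟩ : ∃ k' : ℕ, k = (k' : ℤ) := ⟨k.natAbs, by omega⟩
      rw [hk']
      exact hfan M n n' k' hn hn' hnn' hnM hn'M (by omega)

/-- Hence: `CorrelationNoiseLaw ⟹ MAD`, bookkeeping discharged. -/
theorem mad_of_noise (h : CorrelationNoiseLaw) : CosetDecorrelation ∧ FanDecorrelation :=
  madFromNoise_holds fanSumNeg_holds fanEmptyLargeK_holds h

end NoiseProof

end

end Summit.Parity.GeneralizedHardyLittlewood.Cruxes.FanDecorrelation.LagWindow
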